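import Summits.ResolutionOfSingularities.ResolutionOfSingularities.Theorems.EquisingularLiftEquisingularLiftNatModelStep
import Summits.ResolutionOfSingularities.ResolutionOfSingularities.Theorems.EquisingularLiftEquisingularLiftSplit
import HarnessLib

/-!
# [OURS · L1 W4.5(b) · EL♮(3)] INPUT (b) «E1-LEGALITY» OF THE ROOTS, FROM THE CHAIN ALONE: a centre whose reduced special-fibre trace does not
# contain the running strict transform lies off the generic point of `Y`

Crux chain w45b (cell `res-hironaka`, slot W4.5(b)), working crux **EL♮** = stmt-ResolutionOfSingularities-20038, child **EL♮(3)** =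
stmt-ResolutionOfSingularities-20148, route EquisingularLift, line `sections`; registered stub `stub_elnat_coneTowerPointResolution` (CHILD v20
b3765926fa2d2fc5; `₄` per RULING-8). Written by res-L1-w45b-stub-4 g8 (TOWER₃ assembly inputs (e)/(b), res-L1-w45b-plan-1 AMENDMENT 2 / GO
2026-08-27T20:14:38Z / RULING-8 20:28:31Z). HONEST FRAMING: OURS; NOT a statement of any manuscript; AI-written, weaker than expert review.
No `sorry`; standard axioms; DEF-FREE. `--supports stmt-ResolutionOfSingularities-20148 --as helper`.

WHAT. Input (b) of res-L1-w45b-stub-2's roots `DirLift.ruled_curveStep_root` / `ruled_round_root` (…NatTowerRuledRoots p562947, binder text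
`L/res-L1-w45b-stub-2/ROOTS-INPUTS.sig.txt` 978abd3aff7daeaa) is `hCoff : σ '' supp 𝒞 ⊆ {p | ¬ IsGenericPoint p Y}`. res-D-pv-029's stand-ins
`hRootCurve` / `hRootRound` (mirror `D/res-D-pv-029/gen8/TowerAssembly.lean`) do not carry it among their binders — but it FOLLOWS from the binders
they do carry plus the tower context, with no appeal to clause (e-iv) of `Tower.Exc₂`:

`image_support_subset_not_isGenericPoint_of_chain`: for a `Ch`-stage `(X, σ, S)` with `Chain P Y X σ S`, model square `jG : G ⟶ X` over
`Spec θ` (`θ : O → k` surjective, `Y` inside the special fibre), `jG '' T = S`, and an ideal sheaf `𝒞` with EXACT REDUCED TRACE `𝒞.comap jG = 𝓘⟨Z⟩`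
for a closed `Z ⊆ G` NOT CONTAINING `T`: `σ '' supp 𝒞 ⊆ {p | ¬ IsGenericPoint p Y}`.
PROOF. If `σ x = ξ` is the generic point of `Y` for some `x ∈ supp 𝒞`, then by the STRUCTURE LEMMA `Chain.fibre` (…Split) `σ⁻¹{ξ} = {ξ'}` and
`S = closure {ξ'}`, so `x = ξ'`; `q ξ` is the closed point, so `x = jG g` lies in the special fibre; `g ∈ supp (𝒞.comap jG) = Z`; and `jG` is a
closed embedding, so `T ⊆ jG⁻¹(closure {jG g}) = closure {g} ⊆ Z` — contradiction. USES: the curve step (`Z := Z₉ ⊆ T₉`, `¬ T₉ ⊆ Z₉` of the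
driver's (curve) clause) and every round (`Z ⊆ E ∩ T`, `¬ T ⊆ E` of `Tower.Inv₂`): corollaries `…_of_subset` below.

References (index only): res-D-pv-029 …NatModelStep (`range_eq_preimage_of_isPullback`, `range_specMap_of_surjective_of_field`), …NatTowerConeRound
p558403 (the inline (e-iv) route this replaces); crux file …Split `Chain.fibre` (STRUCTURE LEMMA).
-/

set_option linter.dupNamespace false -- mandated namespace `Summit.<Summit>.<Problem>` of this single-conjunct summit

noncomputable section

open CategoryTheory CategoryTheory.Limits AlgebraicGeometry TopologicalSpace Topology IsLocalRing
open Literature.AlgebraicGeometry.Resolution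
open AlgebraicGeometry.Scheme.IdealSheafData
open Summit.ResolutionOfSingularities.ResolutionOfSingularities.Theses.EquisingularLift.Split

namespace Summit.ResolutionOfSingularities.ResolutionOfSingularities.Cruxes.EquisingularLiftNat.Sections

/-- **E1-legality from the chain** (see the module docstring): on a `Ch`-stage `(X, σ, S)` with model square `jG` and `jG '' T = S`, an
ideal sheaf whose exact reduced special-fibre trace is a closed `Z` not containing `T` has its `σ`-image off the generic point of `Y`.
[OURS · elementary topology over `Chain.fibre`] toward `stub_elnat_coneTowerPointResolution` (stmt-ResolutionOfSingularities-20148 / -20038):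
input (b) of `DirLift.ruled_curveStep_root` / `ruled_round_root`; NOT a statement of the manuscript. -/
theorem image_support_subset_not_isGenericPoint_of_chain {O : Type} [CommRing O] [IsLocalRing O] {k : Type} [Field k]
    (θ : O →+* k) (hθ : Function.Surjective θ) {P : Scheme.{0}} (q : P ⟶ Spec (.of O)) (Y : Set P)
    (hYsp : Y ⊆ q ⁻¹' {closedPoint O}) {X : Scheme.{0}} (σ : X ⟶ P) (S : Set X) (hCh : Chain P Y X σ S)
    {G : Scheme.{0}} (jG : G ⟶ X) (tG : G ⟶ Spec (.of k)) (hsq : IsPullback jG tG (σ ≫ q) (Spec.map (CommRingCat.ofHom θ)))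
    (T : Set G) (hTS : jG '' T = S) (𝒞 : X.IdealSheafData) (Z : Set G) (hZ : IsClosed Z)
    (hCZ : 𝒞.comap jG = vanishingIdeal ⟨Z, hZ⟩) (hTZ : ¬ T ⊆ Z) :
    σ '' (𝒞.support : Set X) ⊆ {p : P | ¬ IsGenericPoint p Y} := by
  rintro _ ⟨x, hx, rfl⟩ hgen
  apply hTZ
  -- the fibre of the chain over the generic point of `Y` is the single point `ξ'`, and `S = closure {ξ'}`
  obtain ⟨ξ', hfib, hS⟩ := Chain.fibre hCh hgen
  have hxξ : x = ξ' := by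
    have h1 : x ∈ σ ⁻¹' {σ x} := rfl
    rw [hfib] at h1
    exact h1
  -- `x` lies in the special fibre, i.e. in the range of `jG`
  haveI : IsClosedImmersion (Spec.map (CommRingCat.ofHom θ)) := IsClosedImmersion.spec_of_surjective _ hθ
  haveI : IsClosedImmersion jG := MorphismProperty.IsStableUnderBaseChange.of_isPullback hsq.flip inferInstance
  have hxr : x ∈ Set.range jG := by
    rw [range_eq_preimage_of_isPullback hsq, range_specMap_of_surjective_of_field θ hθ]
    exact hYsp hgen.mem
  obtain ⟨g, rfl⟩ := hxr
  -- `g ∈ Z`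
  have hgZ : g ∈ Z := by
    have h1 : g ∈ ((𝒞.comap jG).support : Set G) := by
      rw [Scheme.IdealSheafData.support_comap]
      exact hx
    rw [hCZ, coe_support_vanishingIdeal] at h1
    exact h1
  -- `T ⊆ closure {g} ⊆ Z`
  have hce : IsClosedEmbedding jG := jG.isClosedEmbedding
  intro t ht
  have htS : jG t ∈ S := hTS ▸ ⟨t, ht, rfl⟩
  rw [hS, ← hxξ] at htS
  have htg : t ∈ closure ({g} : Set G) := by
    rw [hce.isInducing.closure_eq_preimage_closure_image, Set.image_singleton]
    exact htS
  exact hZ.closure_subset_iff.mpr (Set.singleton_subset_iff.mpr hgZ) htg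

/-- **E1-legality at a ROUND** (`Z ⊆ E`, `¬ T ⊆ E` — the shape of `Tower.Inv₂`'s bookkeeping and `TowerRound`'s `Z ⊆ E ∩ T`).
[OURS · corollary] -/
theorem image_support_subset_not_isGenericPoint_of_chain_of_subset {O : Type} [CommRing O] [IsLocalRing O] {k : Type}
    [Field k] (θ : O →+* k) (hθ : Function.Surjective θ) {P : Scheme.{0}} (q : P ⟶ Spec (.of O)) (Y : Set P)
    (hYsp : Y ⊆ q ⁻¹' {closedPoint O}) {X : Scheme.{0}} (σ : X ⟶ P) (S : Set X) (hCh : Chain P Y X σ S)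
    {G : Scheme.{0}} (jG : G ⟶ X) (tG : G ⟶ Spec (.of k)) (hsq : IsPullback jG tG (σ ≫ q) (Spec.map (CommRingCat.ofHom θ)))
    (T : Set G) (hTS : jG '' T = S) (𝒞 : X.IdealSheafData) (Z : Set G) (hZ : IsClosed Z)
    (hCZ : 𝒞.comap jG = vanishingIdeal ⟨Z, hZ⟩) (E : Set G) (hZE : Z ⊆ E) (hTE : ¬ T ⊆ E) :
    σ '' (𝒞.support : Set X) ⊆ {p : P | ¬ IsGenericPoint p Y} :=
  image_support_subset_not_isGenericPoint_of_chain θ hθ q Y hYsp σ S hCh jG tG hsq T hTS 𝒞 Z hZ hCZ fun h => hTE (h.trans hZE)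

end Summit.ResolutionOfSingularities.ResolutionOfSingularities.Cruxes.EquisingularLiftNat.Sections

end
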